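import Literature.NumberTheory.Transcendental.KZCalculusProofs
import Literature.NumberTheory.Transcendental.KZProductIdeal

/-!
# Line `effective-end-monoid` of crux `ReducedPeriodRing` (stmt-KontsevichZagierPeriods-3929):
# stubs S2a `stub_cubeAddCov_sound`, S2b `stub_cubeNewtonLeibniz_sound`, S2c `stub_cubeHalving_sound` — PROVED

Candidate proofs in the LEAD'S vocabulary (refuter by-product of the drefute pass; positive, hence
attached as evidence, not landed by the refuter). The block `-- BEGIN DEFS … -- END DEFS` is copied
VERBATIM from the lead's skeleton `Cruxes/ReducedPeriodRing/Lines/effective-end-monoid.lean`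
(to become `Theorems/FurushoPentagonReducedPeriodRingDefs.lean`); once that file is landed, delete
the block here and `import` it — the three `stub_…_sound` theorems below then have exactly the
registered signatures (stub registry 2026-08-16T02:18:59Z).

* (1b) `cubeIntegrandAddRel` = an `integrandAddRel` instance;
* (3)  `cubeNewtonLeibnizRel` = a `newtonLeibnizRel` instance with `a = 0`, `b = 1`
       (`unitCube_succ_eq_band`: the cube `[0,1]ⁿ⁺¹` is the band over `[0,1]ⁿ`);
* (2)  `cubeChangeOfVariablesRel` = a `changeOfVariablesRel` instance;
* (1a) `cubeHalvingRel` = domain additivity along the null wall `xᵢ = ½`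
       (`Measure.pi_hyperplane`) + two affine change-of-variables moves
       `Φ₁ x = (x with xᵢ ↦ xᵢ/2)`, `Φ₂ x = (x with xᵢ ↦ (1+xᵢ)/2)`, `|det| = ½` (`det_halfCLM`).

`lean check`: rc 0, 0 sorry, 0 warnings; axioms {propext, Classical.choice, Quot.sound}.
-/

noncomputable section

namespace Summit.KontsevichZagierPeriods.FurushoPentagon.ReducedPeriodRing
-- BEGIN DEFS (verbatim body of Theorems/FurushoPentagonReducedPeriodRingDefs.lean)


open Set
open Literature.NumberTheory.Transcendental Literature.NumberTheory.Transcendental.KZ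

/-- The closed unit cube `[0,1]ⁿ = {x : ℝⁿ | ∀ i, 0 ≤ x i ≤ 1}`.
[Kontsevich–Zagier 2001, §1.1; Ayoub 2014, Def. 6] -/
def unitCube (n : ℕ) : Set (Fin n → ℝ) := {x | ∀ i, 0 ≤ x i ∧ x i ≤ 1}

/-- Membership in the unit cube. [folklore] -/
@[simp] theorem mem_unitCube {n : ℕ} (x : Fin n → ℝ) : x ∈ unitCube n ↔ ∀ i, 0 ≤ x i ∧ x i ≤ 1 :=
  Iff.rfl

/-- The *tame cube classes*: generators `[r]` of `KZ.FormalRep` whose domain is the closed unit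
cube and whose integrand is real analytic on a neighbourhood of each point of the cube.
[Ayoub 2014, Def. 6 (generators of `P^eff_KZ`); Huber–Müller-Stach 2017, §12.1] -/
def cubicalGens : Set FormalRep :=
  {d | ∃ (n : ℕ) (r : IntegralRep n),
    r.domain = unitCube n ∧ AnalyticOnNhd ℝ r.integrand (unitCube n) ∧ d = of r}

/-- The subgroup of `KZ.FormalRep` generated by the tame cube classes (`ℤ[tame cube classes]`).
[Ayoub 2014, Def. 6] -/
def cubicalSpan : AddSubgroup FormalRep := AddSubgroup.closure cubicalGens

/-- **Cubical move (1b)**: integrand additivity `f = f₁ + f₂` between tame cube classes of the same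
dimension. [Kontsevich–Zagier 2001, §1.2 rule (1)] -/
def cubeIntegrandAddRel : Set FormalRep :=
  {c | ∃ (n : ℕ) (r r₁ r₂ : IntegralRep n),
    r.domain = unitCube n ∧ AnalyticOnNhd ℝ r.integrand (unitCube n) ∧
    r₁.domain = unitCube n ∧ AnalyticOnNhd ℝ r₁.integrand (unitCube n) ∧
    r₂.domain = unitCube n ∧ AnalyticOnNhd ℝ r₂.integrand (unitCube n) ∧
    EqOn r.integrand (r₁.integrand + r₂.integrand) (unitCube n) ∧
    c = of r - of r₁ - of r₂}

/-- **Cubical move (3)**: Newton–Leibniz along the last coordinate of the cube `[0,1]ⁿ⁺¹ → [0,1]ⁿ`,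
`∫_{[0,1]ⁿ⁺¹} ∂ₜF = ∫_{[0,1]ⁿ} (F(x,1) − F(x,0))`, for a primitive `F` which is analytic on a
neighbourhood of the cube, `ℚ`-semialgebraic on it, and has `∂ₜ F = f` on every closed fibre.
[Kontsevich–Zagier 2001, §1.2 rule (3); Ayoub 2014, Def. 6 (Stokes generators)] -/
def cubeNewtonLeibnizRel : Set FormalRep :=
  {c | ∃ (n : ℕ) (r : IntegralRep (n + 1)) (r' : IntegralRep n) (F : (Fin (n + 1) → ℝ) → ℝ),
    r.domain = unitCube (n + 1) ∧ AnalyticOnNhd ℝ r.integrand (unitCube (n + 1)) ∧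
    r'.domain = unitCube n ∧ AnalyticOnNhd ℝ r'.integrand (unitCube n) ∧
    AnalyticOnNhd ℝ F (unitCube (n + 1)) ∧ IsSemialgebraicFunOn ℚ (unitCube (n + 1)) F ∧
    (∀ x ∈ unitCube n, ∀ t ∈ Icc (0 : ℝ) 1,
      HasDerivAt (fun s : ℝ => F (Fin.snoc x s)) (r.integrand (Fin.snoc x t)) t) ∧
    (∀ x ∈ unitCube n, r'.integrand x = F (Fin.snoc x 1) - F (Fin.snoc x 0)) ∧
    c = of r - of r'}

/-- **Cubical move (2)**: change of variables along a `ℚ`-semialgebraic analytic diffeomorphism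
`Φ` of the cube onto itself, `∫_{[0,1]ⁿ} f'(Φ x) |det Φ'(x)| = ∫_{[0,1]ⁿ} f'`.
[Kontsevich–Zagier 2001, §1.2 rule (2)] -/
def cubeChangeOfVariablesRel : Set FormalRep :=
  {c | ∃ (n : ℕ) (r r' : IntegralRep n) (Φ : (Fin n → ℝ) → (Fin n → ℝ))
      (Φ' : (Fin n → ℝ) → ((Fin n → ℝ) →L[ℝ] (Fin n → ℝ))),
    r.domain = unitCube n ∧ AnalyticOnNhd ℝ r.integrand (unitCube n) ∧
    r'.domain = unitCube n ∧ AnalyticOnNhd ℝ r'.integrand (unitCube n) ∧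
    IsSemialgebraicMapOn ℚ (unitCube n) Φ ∧
    (∀ x ∈ unitCube n, HasFDerivWithinAt Φ (Φ' x) (unitCube n) x) ∧
    InjOn Φ (unitCube n) ∧ Φ '' unitCube n = unitCube n ∧
    (∀ i : Fin n, AnalyticOnNhd ℝ (fun x : Fin n → ℝ => Φ x i) (unitCube n)) ∧
    (∀ x ∈ unitCube n, r.integrand x = r'.integrand (Φ x) * |(Φ' x).det|) ∧
    c = of r - of r'}

/-- **Cubical move (1a)**: dyadic halving of the `i`-th coordinate,
`∫_{[0,1]ⁿ} f = ∫_{[0,1]ⁿ} ½ f(…, xᵢ/2, …) + ∫_{[0,1]ⁿ} ½ f(…, (1+xᵢ)/2, …)` (domain additivity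
along the null wall `xᵢ = ½` followed by the two affine rescalings of the halves to the cube).
[Kontsevich–Zagier 2001, §1.2 rules (1), (2)] -/
def cubeHalvingRel : Set FormalRep :=
  {c | ∃ (n : ℕ) (r r₁ r₂ : IntegralRep n) (i : Fin n),
    r.domain = unitCube n ∧ AnalyticOnNhd ℝ r.integrand (unitCube n) ∧
    r₁.domain = unitCube n ∧ AnalyticOnNhd ℝ r₁.integrand (unitCube n) ∧
    r₂.domain = unitCube n ∧ AnalyticOnNhd ℝ r₂.integrand (unitCube n) ∧
    (∀ x ∈ unitCube n, r₁.integrand x = (1 / 2 : ℝ) * r.integrand (Function.update x i (x i / 2))) ∧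
    (∀ x ∈ unitCube n,
      r₂.integrand x = (1 / 2 : ℝ) * r.integrand (Function.update x i ((1 + x i) / 2))) ∧
    c = of r - of r₁ - of r₂}

/-- The four cubical move families together. [Kontsevich–Zagier 2001, §1.2] -/
def cubeMoves : Set FormalRep :=
  cubeIntegrandAddRel ∪ cubeNewtonLeibnizRel ∪ cubeChangeOfVariablesRel ∪ cubeHalvingRel

/-- The subgroup of `KZ.FormalRep` generated by the cubical moves: the relations of the cubical
effective sub-calculus (`A_□ = cubicalSpan ⧸ cubeRelations`). [Kontsevich–Zagier 2001, §1.2] -/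
def cubeRelations : AddSubgroup FormalRep := AddSubgroup.closure cubeMoves

/-- Each cubical move family lies in `cubeMoves`. [folklore] -/
theorem cubeIntegrandAddRel_subset_cubeMoves : cubeIntegrandAddRel ⊆ cubeMoves := fun _ hc =>
  Or.inl (Or.inl (Or.inl hc))

/-- Each cubical move family lies in `cubeMoves`. [folklore] -/
theorem cubeNewtonLeibnizRel_subset_cubeMoves : cubeNewtonLeibnizRel ⊆ cubeMoves := fun _ hc =>
  Or.inl (Or.inl (Or.inr hc))

/-- Each cubical move family lies in `cubeMoves`. [folklore] -/
theorem cubeChangeOfVariablesRel_subset_cubeMoves : cubeChangeOfVariablesRel ⊆ cubeMoves :=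
  fun _ hc => Or.inl (Or.inr hc)

/-- Each cubical move family lies in `cubeMoves`. [folklore] -/
theorem cubeHalvingRel_subset_cubeMoves : cubeHalvingRel ⊆ cubeMoves := fun _ hc => Or.inr hc

-- END DEFS

open Set MeasureTheory MvPolynomial
open Literature.NumberTheory.Transcendental Literature.NumberTheory.Transcendental.KZ
open Literature.ModelTheory.ExponentialFields (IsSemialgebraic)

theorem mem_unitCube' {k : ℕ} (x : Fin k → ℝ) : x ∈ unitCube k ↔ ∀ i, 0 ≤ x i ∧ x i ≤ 1 := Iff.rfl

/-! ## (A) -/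

theorem cubeIntegrandAddRel_subset_relations : cubeIntegrandAddRel ⊆ (relations : Set FormalRep) := by
  rintro c ⟨n, r, r₁, r₂, hd, -, hd₁, -, hd₂, -, hsum, rfl⟩
  refine integrandAddRel_subset_relations ⟨n, r, r₁, r₂, ?_, ?_, ?_, rfl⟩
  · rw [hd₁, hd]
  · rw [hd₂, hd]
  · rw [hd]; exact hsum

/-! ## (B) -/

/-- The cube in dimension `n + 1` is the band over the cube in dimension `n` with `a = 0`, `b = 1`. -/
theorem unitCube_succ_eq_band (n : ℕ) :
    unitCube (n + 1) = {z : Fin (n + 1) → ℝ | (Fin.init z : Fin n → ℝ) ∈ unitCube n ∧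
      (fun _ : Fin n → ℝ => (0 : ℝ)) (Fin.init z) ≤ z (Fin.last n) ∧
      z (Fin.last n) ≤ (fun _ : Fin n → ℝ => (1 : ℝ)) (Fin.init z)} := by
  ext z
  simp only [mem_unitCube', mem_setOf_eq, Fin.init]
  rw [Fin.forall_fin_succ']

theorem cubeNewtonLeibnizRel_subset_relations : cubeNewtonLeibnizRel ⊆ (relations : Set FormalRep) := by
  rintro c ⟨n, r, r', F, hd, -, hd', -, -, hF, hderiv, hval, rfl⟩
  refine newtonLeibnizRel_subset_relations
    ⟨n, r, r', fun _ => 0, fun _ => 1, F, ?_, ?_, ?_, ?_, ?_, ?_, ?_, ?_, rfl⟩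
  · rw [hd]; exact hF
  · exact (isSemialgebraicFunOn_aeval r'.isSemialgebraic_domain 0).congr fun x _ => by simp
  · exact (isSemialgebraicFunOn_aeval r'.isSemialgebraic_domain 1).congr fun x _ => by simp
  · intro x _; norm_num
  · rw [hd, hd']; exact unitCube_succ_eq_band n
  · intro x hx
    rw [hd'] at hx
    exact fun t ht => ((hderiv x hx t ht).continuousAt).continuousWithinAt
  · intro x hx t ht
    rw [hd'] at hx
    exact hderiv x hx t (Ioo_subset_Icc_self ht)
  · intro x hx
    rw [hd'] at hx
    exact hval x hx

/-! ## (C) -/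

theorem cubeChangeOfVariablesRel_subset_relations : cubeChangeOfVariablesRel ⊆ (relations : Set FormalRep) := by
  rintro c ⟨n, r, r', Φ, Φ', hd, -, hd', -, hΦ, hderiv, hinj, himage, -, hint, rfl⟩
  refine changeOfVariablesRel_subset_relations ⟨n, r, r', Φ, Φ', ?_, ?_, ?_, ?_, ?_, rfl⟩
  · rw [hd]; exact hΦ
  · rw [hd]; exact hderiv
  · rw [hd]; exact hinj
  · rw [hd, hd', himage]
  · rw [hd]; exact hint

/-! ## (D): dyadic halving -/

variable {n : ℕ}

/-! ## The halving linear map `x ↦ (x with xᵢ ↦ xᵢ/2)` -/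

/-- diagonal matrix `diag(1,…,1/2,…,1)` as a linear map -/
def halfLin (i : Fin n) : (Fin n → ℝ) →ₗ[ℝ] (Fin n → ℝ) :=
  Matrix.toLin' (Matrix.diagonal (Function.update (1 : Fin n → ℝ) i (1 / 2)))

theorem halfLin_apply (i : Fin n) (x : Fin n → ℝ) :
    halfLin i x = Function.update x i (x i / 2) := by
  funext j
  rw [halfLin, Matrix.toLin'_apply, Matrix.mulVec_diagonal]
  by_cases h : j = i
  · subst h; simp; ring
  · simp [h]

theorem det_halfLin (i : Fin n) : LinearMap.det (halfLin i) = 1 / 2 := by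
  rw [halfLin, LinearMap.det_toLin', Matrix.det_diagonal,
    Finset.prod_update_of_mem (Finset.mem_univ i)]
  simp

/-- the same as a continuous linear map -/
def halfCLM (i : Fin n) : (Fin n → ℝ) →L[ℝ] (Fin n → ℝ) := LinearMap.toContinuousLinearMap (halfLin i)

theorem halfCLM_apply (i : Fin n) (x : Fin n → ℝ) :
    halfCLM i x = Function.update x i (x i / 2) := by
  rw [halfCLM, LinearMap.coe_toContinuousLinearMap', halfLin_apply]

theorem det_halfCLM (i : Fin n) : (halfCLM i).det = 1 / 2 := by
  rw [ContinuousLinearMap.det, halfCLM, LinearMap.coe_toContinuousLinearMap, det_halfLin]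

/-- the two affine charts of the half cubes -/
def Φ₁ (i : Fin n) : (Fin n → ℝ) → (Fin n → ℝ) := fun x => Function.update x i (x i / 2)

def Φ₂ (i : Fin n) : (Fin n → ℝ) → (Fin n → ℝ) := fun x => Function.update x i ((1 + x i) / 2)

theorem Φ₁_eq (i : Fin n) : Φ₁ i = ⇑(halfCLM i) := by
  funext x; rw [halfCLM_apply]; rfl

theorem Φ₂_eq (i : Fin n) : Φ₂ i = fun x => halfCLM i x + Function.update (0 : Fin n → ℝ) i (1 / 2) := by
  funext x
  rw [halfCLM_apply]
  funext j
  by_cases h : j = i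
  · subst h; simp [Φ₂]; ring
  · simp [Φ₂, h]

theorem Φ₁_apply_self (i : Fin n) (x : Fin n → ℝ) : Φ₁ i x i = x i / 2 := by simp [Φ₁]
theorem Φ₁_apply_ne (i : Fin n) (x : Fin n → ℝ) {j : Fin n} (h : j ≠ i) : Φ₁ i x j = x j := by
  simp [Φ₁, h]
theorem Φ₂_apply_self (i : Fin n) (x : Fin n → ℝ) : Φ₂ i x i = (1 + x i) / 2 := by simp [Φ₂]
theorem Φ₂_apply_ne (i : Fin n) (x : Fin n → ℝ) {j : Fin n} (h : j ≠ i) : Φ₂ i x j = x j := by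
  simp [Φ₂, h]

theorem hasFDerivWithinAt_Φ₁ (i : Fin n) (s : Set (Fin n → ℝ)) (x : Fin n → ℝ) :
    HasFDerivWithinAt (Φ₁ i) (halfCLM i) s x := by
  rw [Φ₁_eq]; exact (halfCLM i).hasFDerivWithinAt

theorem hasFDerivWithinAt_Φ₂ (i : Fin n) (s : Set (Fin n → ℝ)) (x : Fin n → ℝ) :
    HasFDerivWithinAt (Φ₂ i) (halfCLM i) s x := by
  rw [Φ₂_eq]; exact (halfCLM i).hasFDerivWithinAt.add_const _

theorem injective_Φ₁ (i : Fin n) : Function.Injective (Φ₁ i) := by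
  intro x y h
  funext j
  by_cases hj : j = i
  · subst hj
    have := congrFun h j
    rw [Φ₁_apply_self, Φ₁_apply_self] at this
    linarith
  · have := congrFun h j
    rwa [Φ₁_apply_ne i x hj, Φ₁_apply_ne i y hj] at this

theorem injective_Φ₂ (i : Fin n) : Function.Injective (Φ₂ i) := by
  intro x y h
  funext j
  by_cases hj : j = i
  · subst hj
    have := congrFun h j
    rw [Φ₂_apply_self, Φ₂_apply_self] at this
    linarith
  · have := congrFun h j
    rwa [Φ₂_apply_ne i x hj, Φ₂_apply_ne i y hj] at this

/-! ## The half cubes -/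

def cubeL (i : Fin n) : Set (Fin n → ℝ) := {x | x ∈ unitCube n ∧ x i ≤ 1 / 2}
def cubeR (i : Fin n) : Set (Fin n → ℝ) := {x | x ∈ unitCube n ∧ 1 / 2 ≤ x i}

theorem isSemialgebraic_unitCube (n : ℕ) : IsSemialgebraic ℚ (unitCube n) := by
  have : unitCube n = ⋂ i ∈ (Finset.univ : Finset (Fin n)),
      ({x : Fin n → ℝ | 0 ≤ aeval x (X i : MvPolynomial (Fin n) ℚ)} ∩
        {x | aeval x (X i : MvPolynomial (Fin n) ℚ) ≤ aeval x (1 : MvPolynomial (Fin n) ℚ)}) := by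
    ext x
    simp [mem_unitCube', forall_and]
  rw [this]
  exact IsSemialgebraic.biInter _ _ fun i _ =>
    (Literature.ModelTheory.ExponentialFields.isSemialgebraic_setOf_eval_nonneg _).inter
      (Literature.ModelTheory.ExponentialFields.isSemialgebraic_setOf_eval_le _ _)

theorem isSemialgebraic_cubeL (i : Fin n) : IsSemialgebraic ℚ (cubeL i) := by
  have : cubeL i = unitCube n ∩ {x : Fin n → ℝ |
      aeval x (X i : MvPolynomial (Fin n) ℚ) ≤ aeval x (C (1 / 2 : ℚ) : MvPolynomial (Fin n) ℚ)} := by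
    ext x
    simp [cubeL]
  rw [this]
  exact (isSemialgebraic_unitCube n).inter
    (Literature.ModelTheory.ExponentialFields.isSemialgebraic_setOf_eval_le _ _)

theorem isSemialgebraic_cubeR (i : Fin n) : IsSemialgebraic ℚ (cubeR i) := by
  have : cubeR i = unitCube n ∩ {x : Fin n → ℝ |
      aeval x (C (1 / 2 : ℚ) : MvPolynomial (Fin n) ℚ) ≤ aeval x (X i : MvPolynomial (Fin n) ℚ)} := by
    ext x
    simp [cubeR]
  rw [this]
  exact (isSemialgebraic_unitCube n).inter
    (Literature.ModelTheory.ExponentialFields.isSemialgebraic_setOf_eval_le _ _)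

theorem unitCube_eq_union (i : Fin n) : unitCube n = cubeL i ∪ cubeR i := by
  ext x
  simp only [cubeL, cubeR, mem_union, mem_setOf_eq]
  constructor
  · intro hx
    rcases le_total (x i) (1 / 2) with h | h
    · exact Or.inl ⟨hx, h⟩
    · exact Or.inr ⟨hx, h⟩
  · rintro (⟨hx, -⟩ | ⟨hx, -⟩) <;> exact hx

theorem volume_cubeL_inter_cubeR (i : Fin n) : volume (cubeL i ∩ cubeR i) = 0 := by
  refine measure_mono_null (t := {x : Fin n → ℝ | x i = 1 / 2}) ?_ ?_
  · rintro x ⟨⟨-, h1⟩, ⟨-, h2⟩⟩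
    exact le_antisymm h1 h2
  · rw [volume_pi]
    exact Measure.pi_hyperplane _ i _

theorem image_Φ₁_unitCube (i : Fin n) : Φ₁ i '' unitCube n = cubeL i := by
  ext y
  simp only [mem_image, cubeL, mem_setOf_eq, mem_unitCube']
  constructor
  · rintro ⟨x, hx, rfl⟩
    refine ⟨fun j => ?_, ?_⟩
    · by_cases hj : j = i
      · subst hj; rw [Φ₁_apply_self]; constructor <;> linarith [(hx j).1, (hx j).2]
      · rw [Φ₁_apply_ne i x hj]; exact hx j
    · rw [Φ₁_apply_self]; linarith [(hx i).2]
  · rintro ⟨hy, hyi⟩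
    refine ⟨Function.update y i (2 * y i), fun j => ?_, ?_⟩
    · by_cases hj : j = i
      · subst hj; simp; constructor <;> linarith [(hy j).1]
      · simp [hj]; exact hy j
    · funext j
      by_cases hj : j = i
      · subst hj; rw [Φ₁_apply_self]; simp
      · rw [Φ₁_apply_ne i _ hj]; simp [hj]

theorem image_Φ₂_unitCube (i : Fin n) : Φ₂ i '' unitCube n = cubeR i := by
  ext y
  simp only [mem_image, cubeR, mem_setOf_eq, mem_unitCube']
  constructor
  · rintro ⟨x, hx, rfl⟩
    refine ⟨fun j => ?_, ?_⟩
    · by_cases hj : j = i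
      · subst hj; rw [Φ₂_apply_self]; constructor <;> linarith [(hx j).1, (hx j).2]
      · rw [Φ₂_apply_ne i x hj]; exact hx j
    · rw [Φ₂_apply_self]; linarith [(hx i).1]
  · rintro ⟨hy, hyi⟩
    refine ⟨Function.update y i (2 * y i - 1), fun j => ?_, ?_⟩
    · by_cases hj : j = i
      · subst hj; simp; constructor <;> linarith [(hy j).2]
      · simp [hj]; exact hy j
    · funext j
      by_cases hj : j = i
      · subst hj; rw [Φ₂_apply_self]; simp
      · rw [Φ₂_apply_ne i _ hj]; simp [hj]

/-! ## Semialgebraicity of the charts -/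

theorem isSemialgebraicMapOn_Φ₁ (i : Fin n) {s : Set (Fin n → ℝ)} (hs : IsSemialgebraic ℚ s) :
    IsSemialgebraicMapOn ℚ s (Φ₁ i) := by
  classical
  refine IsSemialgebraicMapOn.of_forall hs fun j => ?_
  by_cases hj : j = i
  · subst hj
    refine (isSemialgebraicFunOn_aeval hs (C (1 / 2 : ℚ) * X j)).congr fun x _ => ?_
    simp only [Φ₁_apply_self, map_mul, aeval_C, aeval_X]
    simp; ring
  · refine (isSemialgebraicFunOn_aeval hs (X j)).congr fun x _ => ?_
    simp [Φ₁_apply_ne i x hj]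

theorem isSemialgebraicMapOn_Φ₂ (i : Fin n) {s : Set (Fin n → ℝ)} (hs : IsSemialgebraic ℚ s) :
    IsSemialgebraicMapOn ℚ s (Φ₂ i) := by
  classical
  refine IsSemialgebraicMapOn.of_forall hs fun j => ?_
  by_cases hj : j = i
  · subst hj
    refine (isSemialgebraicFunOn_aeval hs (C (1 / 2 : ℚ) * (1 + X j))).congr fun x _ => ?_
    simp only [Φ₂_apply_self, map_mul, map_add, map_one, aeval_C, aeval_X]
    simp; ring
  · refine (isSemialgebraicFunOn_aeval hs (X j)).congr fun x _ => ?_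
    simp [Φ₂_apply_ne i x hj]

/-! ## (D) ⊆ relations -/

theorem cubeHalvingRel_subset_relations : cubeHalvingRel ⊆ (relations : Set FormalRep) := by
  rintro c ⟨n, r, r₁, r₂, i, hd, -, hd₁, -, hd₂, -, h₁, h₂, rfl⟩
  -- restrictions of `r` to the two half cubes
  have hsL : cubeL i ⊆ r.domain := by rw [hd]; exact fun x hx => hx.1
  have hsR : cubeR i ⊆ r.domain := by rw [hd]; exact fun x hx => hx.1
  set rL : IntegralRep n := r.restrict (cubeL i) (isSemialgebraic_cubeL i) hsL with hrL
  set rR : IntegralRep n := r.restrict (cubeR i) (isSemialgebraic_cubeR i) hsR with hrR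
  -- (1a) domain additivity along the null wall `x_i = 1/2`
  have hsplit : KZ.of r - KZ.of rL - KZ.of rR ∈ relations := by
    refine domainAddRel_subset_relations ⟨n, r, rL, rR, ?_, ?_, fun _ _ => rfl, fun _ _ => rfl, rfl⟩
    · rw [hd, hrL, hrR, IntegralRep.domain_restrict, IntegralRep.domain_restrict]
      exact unitCube_eq_union i
    · rw [hrL, hrR, IntegralRep.domain_restrict, IntegralRep.domain_restrict]
      exact volume_cubeL_inter_cubeR i
  -- (2) the left half is the image of the cube under `Φ₁`
  have hcov₁ : KZ.of r₁ - KZ.of rL ∈ relations := by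
    refine changeOfVariablesRel_subset_relations
      ⟨n, r₁, rL, Φ₁ i, fun _ => halfCLM i, ?_, ?_, ?_, ?_, ?_, rfl⟩
    · rw [hd₁]; exact isSemialgebraicMapOn_Φ₁ i (isSemialgebraic_unitCube n)
    · intro x _; exact hasFDerivWithinAt_Φ₁ i _ x
    · exact (injective_Φ₁ i).injOn
    · rw [hrL, IntegralRep.domain_restrict, hd₁]; exact (image_Φ₁_unitCube i).symm
    · intro x hx
      rw [hd₁] at hx
      rw [hrL, IntegralRep.integrand_restrict, det_halfCLM, h₁ x hx,
        abs_of_pos (by norm_num : (0 : ℝ) < 1 / 2)]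
      show 1 / 2 * r.integrand (Φ₁ i x) = r.integrand (Φ₁ i x) * (1 / 2)
      ring
  -- (2) the right half is the image of the cube under `Φ₂`
  have hcov₂ : KZ.of r₂ - KZ.of rR ∈ relations := by
    refine changeOfVariablesRel_subset_relations
      ⟨n, r₂, rR, Φ₂ i, fun _ => halfCLM i, ?_, ?_, ?_, ?_, ?_, rfl⟩
    · rw [hd₂]; exact isSemialgebraicMapOn_Φ₂ i (isSemialgebraic_unitCube n)
    · intro x _; exact hasFDerivWithinAt_Φ₂ i _ x
    · exact (injective_Φ₂ i).injOn
    · rw [hrR, IntegralRep.domain_restrict, hd₂]; exact (image_Φ₂_unitCube i).symm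
    · intro x hx
      rw [hd₂] at hx
      rw [hrR, IntegralRep.integrand_restrict, det_halfCLM, h₂ x hx,
        abs_of_pos (by norm_num : (0 : ℝ) < 1 / 2)]
      show 1 / 2 * r.integrand (Φ₂ i x) = r.integrand (Φ₂ i x) * (1 / 2)
      ring
  have heq : KZ.of r - KZ.of r₁ - KZ.of r₂ =
      (KZ.of r - KZ.of rL - KZ.of rR) - (KZ.of r₁ - KZ.of rL) - (KZ.of r₂ - KZ.of rR) := by abel
  rw [heq]
  exact relations.sub_mem (relations.sub_mem hsplit hcov₁) hcov₂


/-! ## The registered stubs S2a, S2b, S2c -/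

/-- **S2a (soundness of cubical integrand additivity and change of variables).** Both families are
instances of the corresponding KZ moves. [Kontsevich–Zagier 2001, §1.2 rules (1), (2)] -/
theorem stub_cubeAddCov_sound :
    cubeIntegrandAddRel ∪ cubeChangeOfVariablesRel ⊆ (relations : Set FormalRep) :=
  union_subset cubeIntegrandAddRel_subset_relations cubeChangeOfVariablesRel_subset_relations

/-- **S2b (soundness of cubical Newton–Leibniz).** The cube `[0,1]ⁿ⁺¹` is the band `a = 0 ≤ b = 1`
over `[0,1]ⁿ`. [Kontsevich–Zagier 2001, §1.2 rule (3)] -/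
theorem stub_cubeNewtonLeibniz_sound : cubeNewtonLeibnizRel ⊆ (relations : Set FormalRep) :=
  cubeNewtonLeibnizRel_subset_relations

/-- **S2c (soundness of dyadic halving).** Domain additivity along the null wall `xᵢ = ½` and two
affine changes of variables. [Kontsevich–Zagier 2001, §1.2 rules (1), (2)] -/
theorem stub_cubeHalving_sound : cubeHalvingRel ⊆ (relations : Set FormalRep) :=
  cubeHalvingRel_subset_relations

/-- All cubical moves are KZ relations, hence `cubeRelations ≤ relations`. [Kontsevich–Zagier 2001, §1.2] -/
theorem cubeRelations_le_relations' : cubeRelations ≤ relations := by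
  refine (AddSubgroup.closure_le _).mpr ?_
  rintro c (((hc | hc) | hc) | hc)
  · exact cubeIntegrandAddRel_subset_relations hc
  · exact cubeNewtonLeibnizRel_subset_relations hc
  · exact cubeChangeOfVariablesRel_subset_relations hc
  · exact cubeHalvingRel_subset_relations hc

end Summit.KontsevichZagierPeriods.FurushoPentagon.ReducedPeriodRing
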